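import Mathlib
import Literature.MathematicalPhysics.QuantumFieldTheory.Balaban1983to89.B6DomainMajorantSandwich

/-!
# `Balaban1983to89.B6DomainMajorantSandwichProfile` — p. 238 before (2.85) with (2.82) line 3 (p. 237): the
change-of-domain majorant of the third-line operator `□Q′(G′(□̃)² − G′²)Q′*h_□` with the lattice-sum bound (2.61)
entering as an ABSTRACT PROFILE (generic constant), instead of the printed constant c₁(α)

B6 = T. Bałaban, *Propagators and renormalization transformations for lattice gauge theories. II*, Commun. Math. Phys.
**96**, 223–250 (1984) [Balaban1984PropagatorsII].

CITATION HEADER (lean-in-tree rule 2026-08-18).  Cell `pub-balaban`, unit `b2b-balaban-b06-g12` (paper sub-cell B06,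
gen 12 — the owner lineage of `…B6DomainMajorant`, `…B6DomainMajorantSandwich`, `…B6Prop23Assembled`).  Source:
doi:10.1007/bf01240221, held `paper:balaban1984-cmp96-propagators-rt-ii`; journal page = PDF page + 222.  Cell rows
GAPS C-b06g12-6, DIVERGENCE D-b06.21b (the sandwich reading, unchanged); journal claim LINE3-SANDWICH-PROFILE; design
note `HOME/b2b-balaban-b06-g12/SUCCESSOR-DESIGN-hdom-discharge.md` (§3 "blocker first").

THE PRINTED TEXT.  p. 238 [PDF 16], verbatim (OCR `p0016.txt` l.2–6, render `…-p016-x2.png` read as image by gens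
9–12): *"Similar inequalities hold for kernels of the other operators forming R, for example the operator with
G′(□̃)² − G′² is small and an estimate has the factor e^{−δ₀M} because of the usual estimate of the type (1.12) [3]
connected with a change of a domain. This estimate follows from the random walk representations (2.50) for the
operators G′, G′(□̃)."*  p. 234, (2.61): *"sup_{y∈𝔅} Σ_{y′∈𝔅} e^{−αδ₀d(y,y′)} ≦ c₁(α)"* with the printed
c₁(α) = B6.c1 — REFUTED AS TYPED for d ≥ 3 on realised geometries (`…B6Lemma21Counterexample`, GAPS G-A11-1); the
repaired form with a generic constant c is `B6Lemma21Repaired.Ineq261With c g δ₀ α` (GAPS C-A12-2).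

WHY THIS MODULE.  The landed line-3 chain — `B6DomainMajorant.line3_deep_majorant_lemma21` and the four sandwich
theorems of `…B6DomainMajorantSandwich` (`line3_term_majorant`, `line3_term_entry_le`, `line3_R_entry_le`,
`line3_term_majorant_avg`) — consumes the PRINTED (2.61) `B6RandomWalk.Ineq261 d g δ₀ α` and carries the constant
`Ctot (profileK g d δ₀ α) …`; for d ≥ 3 that hypothesis is unsatisfiable on the realised lattices, so the chain's last
links are vacuous exactly where they are wanted (d = 4).  The analytic engine one level down,
`B6DomainMajorant.line3_deep_majorant`, is already GENERIC in the profile: it takes any `K ≥ 0` with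
`Profile g.dist id K` (*"Σ_{y′} e^{−a·d(y,y′)} ≤ K(a) for every a > 0"*, `B6DomainChange.Profile`).  This module
re-exposes the last links in that generality — nothing else changes — so that the generic-constant (2.61) can be fed
in BY NAME: `hPr := B9SectCDiffFrame.profile_of_ineq261With h261W hρ.nonneg` (K = `profileW g c δ₀ α`, r1's node, not
imported here to keep this leaf light), or the printed one `B6DomainMajorant.profile_of_ineq261 h261 hρ.nonneg`
(K = `profileK g d δ₀ α`; the landed theorems are literally these instances — §3 records that as kernel-checked
`example`s).  It is step 0 of the successor design "discharge `hdom` of `B6Prop23Assembled.prop23_assembled` from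
the fine-lattice modules" (design note above): the target hypothesis `hdom` must not inherit the printed-c₁ vacuity.

WHAT THIS MODULE PROVES (kernel-checked; no `sorry`, no axiom beyond Lean's three; every proof is a delegation to the
landed generic engine — no new analysis):
1. `line3_deep_majorant_profile` — `B6DomainMajorant.line3_deep_majorant_lemma21` with `(hK : ∀ a, 0 < a → 0 ≤ K a)
   (hPr : Profile g.dist id K)` in place of `h261 : Ineq261 d g δ₀ α`, conclusion with `Ctot K B₁ θ (δ − α′δ₀)`:
   the fine-lattice majorant `cL·(G′(□̃)² − G′²)·cR ≺ L²(L^jη)⁴·C_tot·e^{−((δ−α′δ₀)/3)M₀}·e^{−((δ−α′δ₀)/6)d(y,y′)}`.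
2. `line3_term_majorant_profile`, `line3_term_entry_le_profile`, `line3_R_entry_le_profile`,
   `line3_term_majorant_avg_profile` — the four sandwich theorems of `…B6DomainMajorantSandwich` in the same
   generality (Q′, Q′* with diagonal majorants c_Q, c_{Q*} commuting with the cuts; kernel form; with C_□h_□ appended;
   the concrete pair Q′ = `avgOp`, Q′* = `pullOp`).
3. §3 two `example`s: the landed printed-constant theorems ARE the instances K = `profileK g d δ₀ α` of items 1–2
   (consistency of the generalisation with the lineage, checked by `exact`).
WHAT IT DOES NOT PROVE: (2.61) in any form (it is the hypothesis `hPr`); the majorants of G′, G′(□̃) and of the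
commutator products, the cut algebra, (2.60) (all hypotheses, as in the parents); the junction with
`B6Prop23Assembled.prop23_assembled` (`hdom`) — that needs, besides this module, the rate relabelling
δ₀ ↦ (δ − α′δ₀)/3 and the kernel dictionary recorded in that module's v1.1 header (successor work).  Value = the
line-3 change-of-domain chain made NON-VACUOUS-IN-PRINCIPLE for d ≥ 3 (usable with the repaired Lemma 2.1), a
bookkeeping generalisation, NOT summit progress.
-/

namespace Literature.MathematicalPhysics.QuantumFieldTheory.Balaban1983to89.B6DomainMajorantSandwichProfile

open Finset Real
open B4Sect5Torus (IsPseudoDist)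
open B6DomainChange (Profile)
open B6RandomWalk (HasMajorant BlockSupp hasMajorant_mono)
open B6RandomWalkHom (HasMajorantHom hasMajorantHom_comp hasMajorantHom_mono hasMajorantHom_iff)
open B9Thm37Sum (mulOp mulOp_apply)
open B9Thm34Inv (entry entry_mul)
open B6DomainMajorant (Ctot Ctot_nonneg profileK profileK_nonneg line3_deep_majorant isDepth_zoneDepth
  zoneDepth_eq_zero le_zoneDepth transfer_len_sq_of_ineq260)
open B6DomainMajorantSandwich (pullOp avgOp cut_sandwich_eq q_sandwich_majorant entry_le_of_hasMajorant_id
  entry_mul_le_of_majorant hasMajorantHom_pullOp hasMajorantHom_avgOp pullOp_comp_mulOp mulOp_comp_avgOp)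

/-! ## §1  The deep evaluation of line 3 with an abstract profile -/

section Deep

variable {g : B6.Geometry} [DecidableEq g.Site] {X : Type}

/-- **(2.82), LINE 3 — the deep evaluation, PROFILE-PARAMETRIC.**  `B6DomainMajorant.line3_deep_majorant_lemma21`
verbatim except that the lattice-sum bound (2.61) enters as an abstract profile `K ≥ 0`,
`Profile g.dist id K` (*"Σ_{y′} e^{−a·d(y,y′)} ≤ K(a)"* for every rate a > 0), in place of the printed
`Ineq261 d g δ₀ α` (constant c₁(α), refuted as typed for d ≥ 3): with the weight P(y) = (L^jη)² of (2.67)₁, the scale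
transfer (2.60) at an exponent α′ under the located size condition L²e^{−α′δ₀RM} ≤ 1, the zone N ≠ ∅ of the cut-off χ,
the cut algebra and the four majorants, the operator `cL·(G′(□̃)² − G′²)·cR` has the 𝔅-majorant
`L²·(L^jη)⁴·Ctot K B₁ θ (δ − α′δ₀)·e^{−((δ−α′δ₀)/3)M₀}·e^{−((δ−α′δ₀)/6)d(y,y′)}` — *"an estimate has the factor
e^{−δ₀M} because of the usual estimate of the type (1.12) [3] connected with a change of a domain"*.  Feed
`hPr := B9SectCDiffFrame.profile_of_ineq261With …` (generic c) or `B6DomainMajorant.profile_of_ineq261 …` (printed).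
[cite: Balaban1984PropagatorsII, p.238 before (2.85) + (2.82) line 3 p.237 + (2.60)–(2.61) p.234] -/
theorem line3_deep_majorant_profile (blk : X → g.Site) (hρ : IsPseudoDist g.dist) {δ₀ α' : ℝ}
    (h260 : B6RandomWalk.Ineq260 g δ₀ α') {K : ℝ → ℝ} (hK : ∀ a, 0 < a → 0 ≤ K a)
    (hPr : Profile g.dist (fun a : g.Site => a) K)
    (hα' : 0 ≤ α' * δ₀) (hRM : 0 ≤ g.R * g.M) (hL : 1 ≤ g.L)
    (hsize : g.L ^ 2 * Real.exp (-(α' * δ₀ * (g.R * g.M))) ≤ 1)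
    (N : Finset g.Site) (hN : N.Nonempty)
    {δ B₁ θ : ℝ} (hκδ : α' * δ₀ < δ) (hB₁ : 0 ≤ B₁) (hθ : 0 ≤ θ)
    {G D Gw : Module.End ℝ (X → ℝ)} {χ cL cR : X → ℝ}
    (hχ1 : ∀ x, |χ x| ≤ 1) (hcL1 : ∀ x, |cL x| ≤ 1) (hcR1 : ∀ x, |cR x| ≤ 1)
    (hcLχ : ∀ x, cL x * χ x = cL x) (hcRχ : ∀ x, χ x * cR x = cR x)
    (hχN : ∀ x, blk x ∉ N → χ x = 1)
    (hGD : G * D = 1) (hDG : D * G = 1)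
    (hχGw : mulOp χ * D * Gw = mulOp χ) (hGwχ : Gw * D * mulOp χ = mulOp χ)
    (hG : HasMajorant blk G (fun a b => B₁ * g.len a ^ 2 * Real.exp (-(δ * g.dist a b))))
    (hGw : HasMajorant blk Gw (fun a b => B₁ * g.len a ^ 2 * Real.exp (-(δ * g.dist a b))))
    (hKGw : HasMajorant blk ((mulOp χ * D - D * mulOp χ) * Gw)
      (fun a b => (if a ∈ N then θ else 0) * Real.exp (-(δ * g.dist a b))))
    (hKG : HasMajorant blk ((mulOp χ * D - D * mulOp χ) * G)
      (fun a b => (if a ∈ N then θ else 0) * Real.exp (-(δ * g.dist a b))))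
    {M₀ : ℝ} (hLdeep : ∀ x, cL x ≠ 0 → ∀ n ∈ N, M₀ ≤ g.dist (blk x) n)
    (hRdeep : ∀ x, cR x ≠ 0 → ∀ n ∈ N, M₀ ≤ g.dist (blk x) n) :
    HasMajorant blk (mulOp cL * (Gw * Gw - G * G) * mulOp cR)
      (fun a b => g.L ^ 2 * (g.len a ^ 2) ^ 2 * Ctot K B₁ θ (δ - α' * δ₀) *
        Real.exp (-((δ - α' * δ₀) / 3 * M₀)) * Real.exp (-((δ - α' * δ₀) / 3 / 2 * g.dist a b))) :=
  line3_deep_majorant blk hρ (isDepth_zoneDepth hρ N hN) (K := K) hK hPr N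
    (fun _ ha => zoneDepth_eq_zero hρ hN ha) (P := fun a => g.len a ^ 2) (fun a => sq_nonneg (g.len a)) hα'
    (pow_nonneg (le_trans zero_le_one hL) 2) (transfer_len_sq_of_ineq260 h260 hα' hRM hL hsize) hκδ hB₁ hθ
    hχ1 hcL1 hcR1 hcLχ hcRχ hχN hGD hDG hχGw hGwχ hG hGw hKGw hKG
    (fun x hx => le_zoneDepth g.dist hN (hLdeep x hx)) (fun x hx => le_zoneDepth g.dist hN (hRdeep x hx))

end Deep

/-! ## §2  The sandwich `□Q′( · )Q′*h_□` with an abstract profile -/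

section Sandwich

variable {g : B6.Geometry} [DecidableEq g.Site] {X : Type}

/-- **THE 𝔅-MAJORANT OF `□Q′(G′(□̃)² − G′²)Q′*h_□`, PROFILE-PARAMETRIC** (p. 237: *"− Σ_□ □Q′(G′(□̃)² −
G′²)Q′\*h_□C_□h_□"*): `B6DomainMajorantSandwich.line3_term_majorant` verbatim with the abstract profile
`(hK, hPr)` in place of the printed (2.61) — cuts `sq` (= □) and `hh` (= h_□) as functions on 𝔅, |·| ≤ 1, inside
the region χ = 1 and at distance ≥ M₀ from the zone N; Q′ ≺ c_Q1, Q′\* ≺ c_{Q\*}1 commuting with the cuts; conclusion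
`□Q′(G′(□̃)² − G′²)Q′*h_□ ≺ c_Qc_{Q*}·L²(L^jη)⁴·Ctot K B₁ θ (δ − α′δ₀)·e^{−((δ−α′δ₀)/3)M₀}·e^{−((δ−α′δ₀)/6)d(y,y′)}`.
[cite: Balaban1984PropagatorsII, (2.82)–(2.83) p.237 + p.238] -/
theorem line3_term_majorant_profile (blk : X → g.Site) (hρ : IsPseudoDist g.dist) {δ₀ α' : ℝ}
    (h260 : B6RandomWalk.Ineq260 g δ₀ α') {K : ℝ → ℝ} (hK : ∀ a, 0 < a → 0 ≤ K a)
    (hPr : Profile g.dist (fun a : g.Site => a) K)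
    (hα' : 0 ≤ α' * δ₀) (hRM : 0 ≤ g.R * g.M) (hL : 1 ≤ g.L)
    (hsize : g.L ^ 2 * Real.exp (-(α' * δ₀ * (g.R * g.M))) ≤ 1)
    (N : Finset g.Site) (hN : N.Nonempty)
    {δ B₁ θ : ℝ} (hκδ : α' * δ₀ < δ) (hB₁ : 0 ≤ B₁) (hθ : 0 ≤ θ)
    {G D Gw : Module.End ℝ (X → ℝ)} {χ : X → ℝ} {sq hh : g.Site → ℝ}
    (hχ1 : ∀ x, |χ x| ≤ 1) (hsq1 : ∀ y, |sq y| ≤ 1) (hh1 : ∀ y, |hh y| ≤ 1)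
    (hsqχ : ∀ x, sq (blk x) * χ x = sq (blk x)) (hhχ : ∀ x, χ x * hh (blk x) = hh (blk x))
    (hχN : ∀ x, blk x ∉ N → χ x = 1)
    (hGD : G * D = 1) (hDG : D * G = 1)
    (hχGw : mulOp χ * D * Gw = mulOp χ) (hGwχ : Gw * D * mulOp χ = mulOp χ)
    (hG : HasMajorant blk G (fun a b => B₁ * g.len a ^ 2 * Real.exp (-(δ * g.dist a b))))
    (hGw : HasMajorant blk Gw (fun a b => B₁ * g.len a ^ 2 * Real.exp (-(δ * g.dist a b))))
    (hKGw : HasMajorant blk ((mulOp χ * D - D * mulOp χ) * Gw)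
      (fun a b => (if a ∈ N then θ else 0) * Real.exp (-(δ * g.dist a b))))
    (hKG : HasMajorant blk ((mulOp χ * D - D * mulOp χ) * G)
      (fun a b => (if a ∈ N then θ else 0) * Real.exp (-(δ * g.dist a b))))
    {M₀ : ℝ} (hsqdeep : ∀ y, sq y ≠ 0 → ∀ n ∈ N, M₀ ≤ g.dist y n)
    (hhdeep : ∀ y, hh y ≠ 0 → ∀ n ∈ N, M₀ ≤ g.dist y n)
    {Qp : (X → ℝ) →ₗ[ℝ] (g.Site → ℝ)} {Qs : (g.Site → ℝ) →ₗ[ℝ] (X → ℝ)} {cQ cQs : ℝ} (hcQs : 0 ≤ cQs)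
    (hQ : HasMajorantHom blk (fun y : g.Site => y) Qp (fun (a b : g.Site) => cQ * (if a = b then (1 : ℝ) else 0)))
    (hQs : HasMajorantHom (fun y : g.Site => y) blk Qs (fun (a b : g.Site) => cQs * (if a = b then (1 : ℝ) else 0)))
    (hQχ : (mulOp sq : Module.End ℝ (g.Site → ℝ)) ∘ₗ Qp = Qp ∘ₗ (mulOp (sq ∘ blk) : Module.End ℝ (X → ℝ)))
    (hQsh : Qs ∘ₗ (mulOp hh : Module.End ℝ (g.Site → ℝ)) = (mulOp (hh ∘ blk) : Module.End ℝ (X → ℝ)) ∘ₗ Qs) :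
    HasMajorant (fun y : g.Site => y) (mulOp sq * (Qp ∘ₗ (Gw * Gw - G * G) ∘ₗ Qs) * mulOp hh)
      (fun a b => cQ * cQs * (g.L ^ 2 * (g.len a ^ 2) ^ 2 * Ctot K B₁ θ (δ - α' * δ₀) *
        Real.exp (-((δ - α' * δ₀) / 3 * M₀)) * Real.exp (-((δ - α' * δ₀) / 3 / 2 * g.dist a b)))) := by
  have hfine := line3_deep_majorant_profile blk hρ h260 hK hPr hα' hRM hL hsize N hN hκδ hB₁ hθ
    (cL := sq ∘ blk) (cR := hh ∘ blk) hχ1 (fun x => hsq1 (blk x)) (fun x => hh1 (blk x)) hsqχ hhχ hχN hGD hDG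
    hχGw hGwχ hG hGw hKGw hKG (M₀ := M₀) (fun x hx => hsqdeep (blk x) hx) (fun x hx => hhdeep (blk x) hx)
  rw [cut_sandwich_eq blk (Gw * Gw - G * G) hQχ hQsh]
  refine q_sandwich_majorant blk cQ cQs hcQs (fun a b => ?_) hQ hQs hfine
  have hC : 0 ≤ Ctot K B₁ θ (δ - α' * δ₀) := Ctot_nonneg hK hB₁ hθ (sub_pos.mpr hκδ)
  have hL2 : 0 ≤ g.L ^ 2 := pow_nonneg (le_trans zero_le_one hL) 2
  positivity

/-- The same in KERNEL LANGUAGE, profile-parametric: |(□Q′(G′(□̃)² − G′²)Q′\*h_□)(δ_{y′})(y)| ≤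
c_Qc_{Q\*}L²(L^jη)⁴·Ctot K·e^{−((δ−α′δ₀)/3)M₀}·e^{−((δ−α′δ₀)/6)d(y,y′)} (`B6DomainMajorantSandwich.line3_term_entry_le`
with the abstract profile) — in the print's kernel convention the left side is the product *"(L^{j′}η)^d(Q′ ⋯ Q′\*)(y, y′)"*
of the first member of (2.83); `B9Thm34Inv.entry` coincides with `B6Prop23Chain.mat` (by `rfl`), the matrix language
of the Prop. 2.3 lineage. [cite: Balaban1984PropagatorsII, (2.83) p.237] -/
theorem line3_term_entry_le_profile (blk : X → g.Site) (hρ : IsPseudoDist g.dist) {δ₀ α' : ℝ}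
    (h260 : B6RandomWalk.Ineq260 g δ₀ α') {K : ℝ → ℝ} (hK : ∀ a, 0 < a → 0 ≤ K a)
    (hPr : Profile g.dist (fun a : g.Site => a) K)
    (hα' : 0 ≤ α' * δ₀) (hRM : 0 ≤ g.R * g.M) (hL : 1 ≤ g.L)
    (hsize : g.L ^ 2 * Real.exp (-(α' * δ₀ * (g.R * g.M))) ≤ 1)
    (N : Finset g.Site) (hN : N.Nonempty)
    {δ B₁ θ : ℝ} (hκδ : α' * δ₀ < δ) (hB₁ : 0 ≤ B₁) (hθ : 0 ≤ θ)
    {G D Gw : Module.End ℝ (X → ℝ)} {χ : X → ℝ} {sq hh : g.Site → ℝ}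
    (hχ1 : ∀ x, |χ x| ≤ 1) (hsq1 : ∀ y, |sq y| ≤ 1) (hh1 : ∀ y, |hh y| ≤ 1)
    (hsqχ : ∀ x, sq (blk x) * χ x = sq (blk x)) (hhχ : ∀ x, χ x * hh (blk x) = hh (blk x))
    (hχN : ∀ x, blk x ∉ N → χ x = 1)
    (hGD : G * D = 1) (hDG : D * G = 1)
    (hχGw : mulOp χ * D * Gw = mulOp χ) (hGwχ : Gw * D * mulOp χ = mulOp χ)
    (hG : HasMajorant blk G (fun a b => B₁ * g.len a ^ 2 * Real.exp (-(δ * g.dist a b))))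
    (hGw : HasMajorant blk Gw (fun a b => B₁ * g.len a ^ 2 * Real.exp (-(δ * g.dist a b))))
    (hKGw : HasMajorant blk ((mulOp χ * D - D * mulOp χ) * Gw)
      (fun a b => (if a ∈ N then θ else 0) * Real.exp (-(δ * g.dist a b))))
    (hKG : HasMajorant blk ((mulOp χ * D - D * mulOp χ) * G)
      (fun a b => (if a ∈ N then θ else 0) * Real.exp (-(δ * g.dist a b))))
    {M₀ : ℝ} (hsqdeep : ∀ y, sq y ≠ 0 → ∀ n ∈ N, M₀ ≤ g.dist y n)
    (hhdeep : ∀ y, hh y ≠ 0 → ∀ n ∈ N, M₀ ≤ g.dist y n)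
    {Qp : (X → ℝ) →ₗ[ℝ] (g.Site → ℝ)} {Qs : (g.Site → ℝ) →ₗ[ℝ] (X → ℝ)} {cQ cQs : ℝ} (hcQs : 0 ≤ cQs)
    (hQ : HasMajorantHom blk (fun y : g.Site => y) Qp (fun (a b : g.Site) => cQ * (if a = b then (1 : ℝ) else 0)))
    (hQs : HasMajorantHom (fun y : g.Site => y) blk Qs (fun (a b : g.Site) => cQs * (if a = b then (1 : ℝ) else 0)))
    (hQχ : (mulOp sq : Module.End ℝ (g.Site → ℝ)) ∘ₗ Qp = Qp ∘ₗ (mulOp (sq ∘ blk) : Module.End ℝ (X → ℝ)))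
    (hQsh : Qs ∘ₗ (mulOp hh : Module.End ℝ (g.Site → ℝ)) = (mulOp (hh ∘ blk) : Module.End ℝ (X → ℝ)) ∘ₗ Qs)
    (y y' : g.Site) :
    |entry (mulOp sq * (Qp ∘ₗ (Gw * Gw - G * G) ∘ₗ Qs) * mulOp hh) y y'| ≤
      cQ * cQs * (g.L ^ 2 * (g.len y ^ 2) ^ 2 * Ctot K B₁ θ (δ - α' * δ₀) *
        Real.exp (-((δ - α' * δ₀) / 3 * M₀)) * Real.exp (-((δ - α' * δ₀) / 3 / 2 * g.dist y y'))) :=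
  entry_le_of_hasMajorant_id (line3_term_majorant_profile blk hρ h260 hK hPr hα' hRM hL hsize N hN hκδ hB₁ hθ hχ1
    hsq1 hh1 hsqχ hhχ hχN hGD hDG hχGw hGwχ hG hGw hKGw hKG hsqdeep hhdeep hcQs hQ hQs hQχ hQsh) y y'

/-- **THE (2.83)-TYPE CHAIN FOR THE THIRD LINE, members 1 ⇒ 2, profile-parametric**
(`B6DomainMajorantSandwich.line3_R_entry_le` with the abstract profile): the kernel of the full third-line term
`□Q′(G′(□̃)² − G′²)Q′*h_□·C_□h_□` of (2.82) is bounded by `c_Qc_{Q*}L²(L^jη)⁴·Ctot K·e^{−((δ−α′δ₀)/3)M₀}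
Σ_{y″} e^{−((δ−α′δ₀)/6)d(y,y″)}|C_□(y″,y′)||h_□(y′)|` — the analogue of the printed second member
*"≤ O(1)(L^jη)⁴ Σ_{y″∈supp h_{□′}} e^{−½δ₀d(y,y″)} c₁(L^{j′}η)^{−d−4}e^{−δ₁(L^{j′}η)^{−1}|y″−y′|}"* before (2.81) is
inserted for |C_□(y″,y′)|. [cite: Balaban1984PropagatorsII, (2.81)–(2.83) p.237] -/
theorem line3_R_entry_le_profile (blk : X → g.Site) (hρ : IsPseudoDist g.dist) {δ₀ α' : ℝ}
    (h260 : B6RandomWalk.Ineq260 g δ₀ α') {K : ℝ → ℝ} (hK : ∀ a, 0 < a → 0 ≤ K a)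
    (hPr : Profile g.dist (fun a : g.Site => a) K)
    (hα' : 0 ≤ α' * δ₀) (hRM : 0 ≤ g.R * g.M) (hL : 1 ≤ g.L)
    (hsize : g.L ^ 2 * Real.exp (-(α' * δ₀ * (g.R * g.M))) ≤ 1)
    (N : Finset g.Site) (hN : N.Nonempty)
    {δ B₁ θ : ℝ} (hκδ : α' * δ₀ < δ) (hB₁ : 0 ≤ B₁) (hθ : 0 ≤ θ)
    {G D Gw : Module.End ℝ (X → ℝ)} {χ : X → ℝ} {sq hh : g.Site → ℝ}
    (hχ1 : ∀ x, |χ x| ≤ 1) (hsq1 : ∀ y, |sq y| ≤ 1) (hh1 : ∀ y, |hh y| ≤ 1)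
    (hsqχ : ∀ x, sq (blk x) * χ x = sq (blk x)) (hhχ : ∀ x, χ x * hh (blk x) = hh (blk x))
    (hχN : ∀ x, blk x ∉ N → χ x = 1)
    (hGD : G * D = 1) (hDG : D * G = 1)
    (hχGw : mulOp χ * D * Gw = mulOp χ) (hGwχ : Gw * D * mulOp χ = mulOp χ)
    (hG : HasMajorant blk G (fun a b => B₁ * g.len a ^ 2 * Real.exp (-(δ * g.dist a b))))
    (hGw : HasMajorant blk Gw (fun a b => B₁ * g.len a ^ 2 * Real.exp (-(δ * g.dist a b))))
    (hKGw : HasMajorant blk ((mulOp χ * D - D * mulOp χ) * Gw)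
      (fun a b => (if a ∈ N then θ else 0) * Real.exp (-(δ * g.dist a b))))
    (hKG : HasMajorant blk ((mulOp χ * D - D * mulOp χ) * G)
      (fun a b => (if a ∈ N then θ else 0) * Real.exp (-(δ * g.dist a b))))
    {M₀ : ℝ} (hsqdeep : ∀ y, sq y ≠ 0 → ∀ n ∈ N, M₀ ≤ g.dist y n)
    (hhdeep : ∀ y, hh y ≠ 0 → ∀ n ∈ N, M₀ ≤ g.dist y n)
    {Qp : (X → ℝ) →ₗ[ℝ] (g.Site → ℝ)} {Qs : (g.Site → ℝ) →ₗ[ℝ] (X → ℝ)} {cQ cQs : ℝ} (hcQs : 0 ≤ cQs)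
    (hQ : HasMajorantHom blk (fun y : g.Site => y) Qp (fun (a b : g.Site) => cQ * (if a = b then (1 : ℝ) else 0)))
    (hQs : HasMajorantHom (fun y : g.Site => y) blk Qs (fun (a b : g.Site) => cQs * (if a = b then (1 : ℝ) else 0)))
    (hQχ : (mulOp sq : Module.End ℝ (g.Site → ℝ)) ∘ₗ Qp = Qp ∘ₗ (mulOp (sq ∘ blk) : Module.End ℝ (X → ℝ)))
    (hQsh : Qs ∘ₗ (mulOp hh : Module.End ℝ (g.Site → ℝ)) = (mulOp (hh ∘ blk) : Module.End ℝ (X → ℝ)) ∘ₗ Qs)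
    (C : Module.End ℝ (g.Site → ℝ)) (y y' : g.Site) :
    |entry (mulOp sq * (Qp ∘ₗ (Gw * Gw - G * G) ∘ₗ Qs) * mulOp hh * (C * mulOp hh)) y y'| ≤
      cQ * cQs * (g.L ^ 2 * (g.len y ^ 2) ^ 2 * Ctot K B₁ θ (δ - α' * δ₀) *
        Real.exp (-((δ - α' * δ₀) / 3 * M₀))) *
        ∑ y'' : g.Site, Real.exp (-((δ - α' * δ₀) / 3 / 2 * g.dist y y'')) * (|entry C y'' y'| * |hh y'|) := by
  have h := entry_mul_le_of_majorant (C := C) (line3_term_majorant_profile blk hρ h260 hK hPr hα' hRM hL hsize N hN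
    hκδ hB₁ hθ hχ1 hsq1 hh1 hsqχ hhχ hχN hGD hDG hχGw hGwχ hG hGw hKGw hKG hsqdeep hhdeep hcQs hQ hQs hQχ hQsh) hh y y'
  refine h.trans (le_of_eq ?_)
  rw [Finset.mul_sum]
  refine Finset.sum_congr rfl fun y'' _ => ?_
  ring

/-- **THE CONCRETE INSTANCE, profile-parametric**: with Q′ = the normalised block average `avgOp blk w` (w ≥ 0,
Σ_{B(y)}w ≤ 1) and Q′\* = the pull-back `pullOp blk`, the hypotheses `hQ`, `hQs`, `hQχ`, `hQsh` hold BY NAME with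
c_Q = c_{Q\*} = 1 (`B6DomainMajorantSandwich.line3_term_majorant_avg` with the abstract profile).
[cite: Balaban1984PropagatorsII, (2.82) p.237 + p.238] -/
theorem line3_term_majorant_avg_profile [Fintype X] (blk : X → g.Site) (hρ : IsPseudoDist g.dist) {δ₀ α' : ℝ}
    (h260 : B6RandomWalk.Ineq260 g δ₀ α') {K : ℝ → ℝ} (hK : ∀ a, 0 < a → 0 ≤ K a)
    (hPr : Profile g.dist (fun a : g.Site => a) K)
    (hα' : 0 ≤ α' * δ₀) (hRM : 0 ≤ g.R * g.M) (hL : 1 ≤ g.L)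
    (hsize : g.L ^ 2 * Real.exp (-(α' * δ₀ * (g.R * g.M))) ≤ 1)
    (N : Finset g.Site) (hN : N.Nonempty)
    {δ B₁ θ : ℝ} (hκδ : α' * δ₀ < δ) (hB₁ : 0 ≤ B₁) (hθ : 0 ≤ θ)
    {G D Gw : Module.End ℝ (X → ℝ)} {χ : X → ℝ} {sq hh : g.Site → ℝ}
    (hχ1 : ∀ x, |χ x| ≤ 1) (hsq1 : ∀ y, |sq y| ≤ 1) (hh1 : ∀ y, |hh y| ≤ 1)
    (hsqχ : ∀ x, sq (blk x) * χ x = sq (blk x)) (hhχ : ∀ x, χ x * hh (blk x) = hh (blk x))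
    (hχN : ∀ x, blk x ∉ N → χ x = 1)
    (hGD : G * D = 1) (hDG : D * G = 1)
    (hχGw : mulOp χ * D * Gw = mulOp χ) (hGwχ : Gw * D * mulOp χ = mulOp χ)
    (hG : HasMajorant blk G (fun a b => B₁ * g.len a ^ 2 * Real.exp (-(δ * g.dist a b))))
    (hGw : HasMajorant blk Gw (fun a b => B₁ * g.len a ^ 2 * Real.exp (-(δ * g.dist a b))))
    (hKGw : HasMajorant blk ((mulOp χ * D - D * mulOp χ) * Gw)
      (fun a b => (if a ∈ N then θ else 0) * Real.exp (-(δ * g.dist a b))))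
    (hKG : HasMajorant blk ((mulOp χ * D - D * mulOp χ) * G)
      (fun a b => (if a ∈ N then θ else 0) * Real.exp (-(δ * g.dist a b))))
    {M₀ : ℝ} (hsqdeep : ∀ y, sq y ≠ 0 → ∀ n ∈ N, M₀ ≤ g.dist y n)
    (hhdeep : ∀ y, hh y ≠ 0 → ∀ n ∈ N, M₀ ≤ g.dist y n)
    {w : X → ℝ} (hw0 : ∀ x, 0 ≤ w x) (hw1 : ∀ y : g.Site, (∑ x : X, if blk x = y then w x else 0) ≤ 1) :
    HasMajorant (fun y : g.Site => y)
      (mulOp sq * (avgOp blk w ∘ₗ (Gw * Gw - G * G) ∘ₗ pullOp blk) * mulOp hh)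
      (fun a b => g.L ^ 2 * (g.len a ^ 2) ^ 2 * Ctot K B₁ θ (δ - α' * δ₀) *
        Real.exp (-((δ - α' * δ₀) / 3 * M₀)) * Real.exp (-((δ - α' * δ₀) / 3 / 2 * g.dist a b))) := by
  have hQ : HasMajorantHom blk (fun y : g.Site => y) (avgOp blk w)
      (fun (a b : g.Site) => (1 : ℝ) * (if a = b then (1 : ℝ) else 0)) :=
    hasMajorantHom_mono _ _ (hasMajorantHom_avgOp blk hw0 hw1) fun a b => by rw [one_mul]
  have hQs : HasMajorantHom (fun y : g.Site => y) blk (pullOp blk)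
      (fun (a b : g.Site) => (1 : ℝ) * (if a = b then (1 : ℝ) else 0)) :=
    hasMajorantHom_mono _ _ (hasMajorantHom_pullOp blk) fun a b => by rw [one_mul]
  have h := line3_term_majorant_profile blk hρ h260 hK hPr hα' hRM hL hsize N hN hκδ hB₁ hθ hχ1 hsq1 hh1 hsqχ hhχ
    hχN hGD hDG hχGw hGwχ hG hGw hKGw hKG hsqdeep hhdeep zero_le_one hQ hQs (mulOp_comp_avgOp blk w sq)
    (pullOp_comp_mulOp blk hh)
  exact hasMajorant_mono (fun y : g.Site => y) h fun a b => by rw [one_mul, one_mul]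

end Sandwich

/-! ## §3  Orientation: the landed printed-constant theorems are the instances K = `profileK` -/

section Orientation

variable {g : B6.Geometry} [DecidableEq g.Site] {X : Type}

/-- The landed `B6DomainMajorant.line3_deep_majorant_lemma21` (printed (2.61), K = `profileK g d δ₀ α`) is the
instance of `line3_deep_majorant_profile` at `hPr := B6DomainMajorant.profile_of_ineq261 h261 hρ.nonneg`
(consistency of the generalisation, checked by `exact`; for d ≥ 3 this instance is vacuous on realised geometries,
G-A11-1 — use the generic-constant profile instead). [folklore] -/
example (blk : X → g.Site) (hρ : IsPseudoDist g.dist) {d : ℕ} {δ₀ α α' : ℝ}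
    (h260 : B6RandomWalk.Ineq260 g δ₀ α') (h261 : B6RandomWalk.Ineq261 d g δ₀ α)
    (hα' : 0 ≤ α' * δ₀) (hRM : 0 ≤ g.R * g.M) (hL : 1 ≤ g.L)
    (hsize : g.L ^ 2 * Real.exp (-(α' * δ₀ * (g.R * g.M))) ≤ 1)
    (N : Finset g.Site) (hN : N.Nonempty)
    {δ B₁ θ : ℝ} (hκδ : α' * δ₀ < δ) (hB₁ : 0 ≤ B₁) (hθ : 0 ≤ θ)
    {G D Gw : Module.End ℝ (X → ℝ)} {χ cL cR : X → ℝ}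
    (hχ1 : ∀ x, |χ x| ≤ 1) (hcL1 : ∀ x, |cL x| ≤ 1) (hcR1 : ∀ x, |cR x| ≤ 1)
    (hcLχ : ∀ x, cL x * χ x = cL x) (hcRχ : ∀ x, χ x * cR x = cR x)
    (hχN : ∀ x, blk x ∉ N → χ x = 1)
    (hGD : G * D = 1) (hDG : D * G = 1)
    (hχGw : mulOp χ * D * Gw = mulOp χ) (hGwχ : Gw * D * mulOp χ = mulOp χ)
    (hG : HasMajorant blk G (fun a b => B₁ * g.len a ^ 2 * Real.exp (-(δ * g.dist a b))))
    (hGw : HasMajorant blk Gw (fun a b => B₁ * g.len a ^ 2 * Real.exp (-(δ * g.dist a b))))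
    (hKGw : HasMajorant blk ((mulOp χ * D - D * mulOp χ) * Gw)
      (fun a b => (if a ∈ N then θ else 0) * Real.exp (-(δ * g.dist a b))))
    (hKG : HasMajorant blk ((mulOp χ * D - D * mulOp χ) * G)
      (fun a b => (if a ∈ N then θ else 0) * Real.exp (-(δ * g.dist a b))))
    {M₀ : ℝ} (hLdeep : ∀ x, cL x ≠ 0 → ∀ n ∈ N, M₀ ≤ g.dist (blk x) n)
    (hRdeep : ∀ x, cR x ≠ 0 → ∀ n ∈ N, M₀ ≤ g.dist (blk x) n) :
    HasMajorant blk (mulOp cL * (Gw * Gw - G * G) * mulOp cR)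
      (fun a b => g.L ^ 2 * (g.len a ^ 2) ^ 2 * Ctot (profileK g d δ₀ α) B₁ θ (δ - α' * δ₀) *
        Real.exp (-((δ - α' * δ₀) / 3 * M₀)) * Real.exp (-((δ - α' * δ₀) / 3 / 2 * g.dist a b))) :=
  line3_deep_majorant_profile blk hρ h260 (fun a _ => profileK_nonneg d δ₀ α a)
    (B6DomainMajorant.profile_of_ineq261 h261 hρ.nonneg) hα' hRM hL hsize N hN hκδ hB₁ hθ hχ1 hcL1 hcR1 hcLχ hcRχ
    hχN hGD hDG hχGw hGwχ hG hGw hKGw hKG hLdeep hRdeep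

/-- … and the landed statement itself is recovered from the profile form (the two sides agree as propositions:
the printed-constant chain is a special case, not a different theorem). [folklore] -/
example (blk : X → g.Site) (hρ : IsPseudoDist g.dist) {d : ℕ} {δ₀ α α' : ℝ}
    (h260 : B6RandomWalk.Ineq260 g δ₀ α') (h261 : B6RandomWalk.Ineq261 d g δ₀ α)
    (hα' : 0 ≤ α' * δ₀) (hRM : 0 ≤ g.R * g.M) (hL : 1 ≤ g.L)
    (hsize : g.L ^ 2 * Real.exp (-(α' * δ₀ * (g.R * g.M))) ≤ 1)
    (N : Finset g.Site) (hN : N.Nonempty)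
    {δ B₁ θ : ℝ} (hκδ : α' * δ₀ < δ) (hB₁ : 0 ≤ B₁) (hθ : 0 ≤ θ)
    {G D Gw : Module.End ℝ (X → ℝ)} {χ : X → ℝ} {sq hh : g.Site → ℝ}
    (hχ1 : ∀ x, |χ x| ≤ 1) (hsq1 : ∀ y, |sq y| ≤ 1) (hh1 : ∀ y, |hh y| ≤ 1)
    (hsqχ : ∀ x, sq (blk x) * χ x = sq (blk x)) (hhχ : ∀ x, χ x * hh (blk x) = hh (blk x))
    (hχN : ∀ x, blk x ∉ N → χ x = 1)
    (hGD : G * D = 1) (hDG : D * G = 1)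
    (hχGw : mulOp χ * D * Gw = mulOp χ) (hGwχ : Gw * D * mulOp χ = mulOp χ)
    (hG : HasMajorant blk G (fun a b => B₁ * g.len a ^ 2 * Real.exp (-(δ * g.dist a b))))
    (hGw : HasMajorant blk Gw (fun a b => B₁ * g.len a ^ 2 * Real.exp (-(δ * g.dist a b))))
    (hKGw : HasMajorant blk ((mulOp χ * D - D * mulOp χ) * Gw)
      (fun a b => (if a ∈ N then θ else 0) * Real.exp (-(δ * g.dist a b))))
    (hKG : HasMajorant blk ((mulOp χ * D - D * mulOp χ) * G)
      (fun a b => (if a ∈ N then θ else 0) * Real.exp (-(δ * g.dist a b))))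
    {M₀ : ℝ} (hsqdeep : ∀ y, sq y ≠ 0 → ∀ n ∈ N, M₀ ≤ g.dist y n)
    (hhdeep : ∀ y, hh y ≠ 0 → ∀ n ∈ N, M₀ ≤ g.dist y n)
    {w : X → ℝ} [Fintype X] (hw0 : ∀ x, 0 ≤ w x) (hw1 : ∀ y : g.Site, (∑ x : X, if blk x = y then w x else 0) ≤ 1) :
    HasMajorant (fun y : g.Site => y)
      (mulOp sq * (avgOp blk w ∘ₗ (Gw * Gw - G * G) ∘ₗ pullOp blk) * mulOp hh)
      (fun a b => g.L ^ 2 * (g.len a ^ 2) ^ 2 * Ctot (profileK g d δ₀ α) B₁ θ (δ - α' * δ₀) *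
        Real.exp (-((δ - α' * δ₀) / 3 * M₀)) * Real.exp (-((δ - α' * δ₀) / 3 / 2 * g.dist a b))) :=
  line3_term_majorant_avg_profile blk hρ h260 (fun a _ => profileK_nonneg d δ₀ α a)
    (B6DomainMajorant.profile_of_ineq261 h261 hρ.nonneg) hα' hRM hL hsize N hN hκδ hB₁ hθ hχ1 hsq1 hh1 hsqχ hhχ
    hχN hGD hDG hχGw hGwχ hG hGw hKGw hKG hsqdeep hhdeep hw0 hw1

end Orientation

end Literature.MathematicalPhysics.QuantumFieldTheory.Balaban1983to89.B6DomainMajorantSandwichProfile
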